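import Literature.Probability.Percolation.KozmaNitzanPinning
import Literature.Probability.Percolation.PercolationEvents
import HarnessLib

/-!
# `NoHeavyLowerTail` (stmt-CriticalPhenomena-4575) — the HUB GRAPH used to calibrate the sharp cumulative
# isolation inequality against Kozma–Nitzan's conjectures (device of [KozmaNitzan2024, Thm 10 proof sketch, p. 32])

Seat `prim-gen-swap` (gen 1), 2026-08-18.  Given a weighted graph on `Fin n`, a vertex `b` and `k : ℕ`, the hub
graph lives on `Fin (n + k)`: old vertices `Fin.castAdd k v`, hubs `Fin.natAdd n i`, each hub joined to `b` by an
edge of weight `1` and to nothing else (`exists_hubWeight`).  This file is pure bookkeeping for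
`…CILSharpHardness.lean`:

* `ae_good` — almost surely every hub edge is open and no other new pair is (the GOOD configurations);
* `reachable_castAdd_iff`, `reachable_natAdd_iff`, `reachable_natAdd_natAdd` — on good configurations, open paths
  of the hub graph project to open paths of the restriction `restrictConfig (Fin.castAdd k)` (hubs project to `b`);
* `card_filter_relays'`, `card_filter_relays'_natAdd` — with relay set `A' = A ∪ {hubs}`:
  `|π_{A'}(v)| = |π_A(v)| + k·1{v ↔ b}` for old `v`, and `|π_{A'}(h_i)| ≥ k`;
* `real_eq_of_good` — `μ'(S') = μ(S)` whenever `S'` and the pull-back of `S` agree on good configurations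
  (marginal `prodBernoulli_map_restrictConfig` + full measure of the good set).
-/

noncomputable section

namespace Summit.CriticalPhenomena.PercolationContinuityZ3.Theorems

open MeasureTheory Set Literature.Probability.LatticeModels Literature.Probability.Percolation
open scoped Classical BigOperators

namespace CILSharpHardness

variable {n k : ℕ}

/-- Old vertices and hub vertices are distinct. [folklore] -/
theorem castAdd_ne_natAdd (v : Fin n) (i : Fin k) : Fin.castAdd k v ≠ Fin.natAdd n i := by
  intro h
  have h1 : (Fin.castAdd k v).val = v.val := rfl
  have h2 : (Fin.natAdd n i).val = n + i.val := rfl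
  have := congrArg Fin.val h
  rw [h1, h2] at this
  have := v.isLt
  omega

/-- The projection `Fin (n+k) → Fin n`: identity on old vertices, every hub goes to `b`. [folklore] -/
theorem exists_proj (b : Fin n) (k : ℕ) :
    ∃ p : Fin (n + k) → Fin n, (∀ v, p (Fin.castAdd k v) = v) ∧ (∀ i, p (Fin.natAdd n i) = b) := by
  refine ⟨fun x => if h : x.val < n then ⟨x.val, h⟩ else b, fun v => ?_, fun i => ?_⟩
  · have : (Fin.castAdd k v).val < n := v.isLt
    simp only [this, dif_pos]
    rfl
  · have : ¬ (Fin.natAdd n i).val < n := by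
      have h2 : (Fin.natAdd n i).val = n + i.val := rfl
      omega
    simp only [this, dif_neg, not_false_eq_true]

/-! A configuration `ω'` of the hub graph is GOOD when every hub edge `s(b, h_i)` is open and every open pair is
either an old pair or a hub edge; the hypothesis `hω` below spells this out (it holds almost surely, `ae_good`). -/

/-- **Projection of open paths.**  On a good configuration every open path of the hub graph projects to an
open path of the restricted configuration (hub edges project to the loop at `b`). [folklore] -/
theorem reachable_proj {b : Fin n} {ω' : BondConfig (Fin (n + k))} (hω : ((∀ i : Fin k, s(Fin.castAdd k b, Fin.natAdd n i) ∈ ω') ∧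
      ∀ e' ∈ ω', (∃ e : Sym2 (Fin n), Sym2.map (Fin.castAdd k) e = e') ∨
        ∃ i : Fin k, e' = s(Fin.castAdd k b, Fin.natAdd n i)))
    {p : Fin (n + k) → Fin n} (hp1 : ∀ v, p (Fin.castAdd k v) = v) (hp2 : ∀ i, p (Fin.natAdd n i) = b)
    {x y : Fin (n + k)} (h : (openGraph ω').Reachable x y) :
    (openGraph (restrictConfig (Fin.castAdd k) ω')).Reachable (p x) (p y) := by
  have hstep : ∀ x y : Fin (n + k), (openGraph ω').Adj x y →
      (openGraph (restrictConfig (Fin.castAdd k) ω')).Reachable (p x) (p y) := by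
    intro x y hxy
    rw [openGraph_adj] at hxy
    rcases hω.2 _ hxy.1 with ⟨e, he⟩ | ⟨i, hi⟩
    · induction e using Sym2.ind with
      | h u v =>
        rw [Sym2.map_mk, Sym2.eq_iff] at he
        have hmem : s(u, v) ∈ restrictConfig (Fin.castAdd k) ω' := by
          rw [mem_restrictConfig, Sym2.map_mk]
          rcases he with ⟨rfl, rfl⟩ | ⟨rfl, rfl⟩
          · exact hxy.1
          · rw [Sym2.eq_swap]; exact hxy.1
        rcases he with ⟨rfl, rfl⟩ | ⟨rfl, rfl⟩
        · rw [hp1, hp1]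
          by_cases huv : u = v
          · subst huv; exact SimpleGraph.Reachable.refl _
          · exact SimpleGraph.Adj.reachable ((openGraph_adj _ u v).2 ⟨hmem, huv⟩)
        · rw [hp1, hp1]
          by_cases huv : u = v
          · subst huv; exact SimpleGraph.Reachable.refl _
          · exact (SimpleGraph.Adj.reachable ((openGraph_adj _ u v).2 ⟨hmem, huv⟩)).symm
    · rw [Sym2.eq_iff] at hi
      rcases hi with ⟨rfl, rfl⟩ | ⟨rfl, rfl⟩
      · rw [hp1, hp2]
      · rw [hp1, hp2]
  obtain ⟨wk⟩ := h
  induction wk with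
  | nil => exact SimpleGraph.Reachable.refl _
  | cons hadj _ ih => exact (hstep _ _ hadj).trans ih

/-- An open path of the restricted configuration pushes forward to the hub graph. [folklore] -/
theorem reachable_castAdd_of_restrict {ω' : BondConfig (Fin (n + k))} {u v : Fin n}
    (h : (openGraph (restrictConfig (Fin.castAdd k) ω')).Reachable u v) :
    (openGraph ω').Reachable (Fin.castAdd k u) (Fin.castAdd k v) := by
  obtain ⟨wk⟩ := h
  induction wk with
  | nil => exact SimpleGraph.Reachable.refl _
  | @cons x y z hxy _ ih =>
    refine (SimpleGraph.Adj.reachable ?_).trans ih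
    rw [openGraph_adj, mem_restrictConfig, Sym2.map_mk] at hxy
    rw [openGraph_adj]
    exact ⟨hxy.1, fun h => hxy.2 (Fin.castAdd_injective _ _ h)⟩

/-- **Old-to-old reachability** in a good configuration is reachability in the restriction. [folklore] -/
theorem reachable_castAdd_iff {b : Fin n} {ω' : BondConfig (Fin (n + k))} (hω : ((∀ i : Fin k, s(Fin.castAdd k b, Fin.natAdd n i) ∈ ω') ∧
      ∀ e' ∈ ω', (∃ e : Sym2 (Fin n), Sym2.map (Fin.castAdd k) e = e') ∨
        ∃ i : Fin k, e' = s(Fin.castAdd k b, Fin.natAdd n i))) (u v : Fin n) :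
    (openGraph ω').Reachable (Fin.castAdd k u) (Fin.castAdd k v) ↔
      (openGraph (restrictConfig (Fin.castAdd k) ω')).Reachable u v := by
  obtain ⟨p, hp1, hp2⟩ := exists_proj b k
  constructor
  · intro h
    have := reachable_proj hω hp1 hp2 h
    rwa [hp1, hp1] at this
  · exact reachable_castAdd_of_restrict

/-- **Old-to-hub reachability** in a good configuration is reachability to `b` in the restriction. [folklore] -/
theorem reachable_natAdd_iff {b : Fin n} {ω' : BondConfig (Fin (n + k))} (hω : ((∀ i : Fin k, s(Fin.castAdd k b, Fin.natAdd n i) ∈ ω') ∧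
      ∀ e' ∈ ω', (∃ e : Sym2 (Fin n), Sym2.map (Fin.castAdd k) e = e') ∨
        ∃ i : Fin k, e' = s(Fin.castAdd k b, Fin.natAdd n i))) (v : Fin n)
    (i : Fin k) :
    (openGraph ω').Reachable (Fin.castAdd k v) (Fin.natAdd n i) ↔
      (openGraph (restrictConfig (Fin.castAdd k) ω')).Reachable v b := by
  obtain ⟨p, hp1, hp2⟩ := exists_proj b k
  have hadj : (openGraph ω').Adj (Fin.castAdd k b) (Fin.natAdd n i) :=
    (openGraph_adj _ _ _).2 ⟨hω.1 i, castAdd_ne_natAdd b i⟩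
  constructor
  · intro h
    have := reachable_proj hω hp1 hp2 h
    rwa [hp1, hp2] at this
  · intro h
    exact (reachable_castAdd_of_restrict h).trans hadj.reachable

/-- Hubs are pairwise joined (through `b`). [folklore] -/
theorem reachable_natAdd_natAdd {b : Fin n} {ω' : BondConfig (Fin (n + k))} (hω : ((∀ i : Fin k, s(Fin.castAdd k b, Fin.natAdd n i) ∈ ω') ∧
      ∀ e' ∈ ω', (∃ e : Sym2 (Fin n), Sym2.map (Fin.castAdd k) e = e') ∨
        ∃ i : Fin k, e' = s(Fin.castAdd k b, Fin.natAdd n i)))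
    (i i' : Fin k) : (openGraph ω').Reachable (Fin.natAdd n i) (Fin.natAdd n i') := by
  have hadj : ∀ i, (openGraph ω').Adj (Fin.castAdd k b) (Fin.natAdd n i) := fun i =>
    (openGraph_adj _ _ _).2 ⟨hω.1 i, castAdd_ne_natAdd b i⟩
  exact (hadj i).reachable.symm.trans (hadj i').reachable

/-- Membership in `A'`. [folklore] -/
theorem mem_relays'_iff (A : Finset (Fin n)) (z : Fin (n + k)) :
    z ∈ (A.map ⟨Fin.castAdd k, Fin.castAdd_injective _ _⟩ ∪
      (Finset.univ : Finset (Fin k)).map ⟨Fin.natAdd n, Fin.natAdd_injective _ _⟩) ↔ (∃ a ∈ A, Fin.castAdd k a = z) ∨ ∃ i : Fin k, Fin.natAdd n i = z := by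
  simp [Finset.mem_union, Finset.mem_map]

/-- **Block counts in the hub graph.**  On a good configuration, for an old vertex `v`:
`|π_{A'}(v)| = |π_A(v)| + k·1{v ↔ b}`. [folklore] -/
theorem card_filter_relays' {b : Fin n} {ω' : BondConfig (Fin (n + k))} (hω : ((∀ i : Fin k, s(Fin.castAdd k b, Fin.natAdd n i) ∈ ω') ∧
      ∀ e' ∈ ω', (∃ e : Sym2 (Fin n), Sym2.map (Fin.castAdd k) e = e') ∨
        ∃ i : Fin k, e' = s(Fin.castAdd k b, Fin.natAdd n i)))
    (A : Finset (Fin n)) (v : Fin n) :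
    ((A.map ⟨Fin.castAdd k, Fin.castAdd_injective _ _⟩ ∪
      (Finset.univ : Finset (Fin k)).map ⟨Fin.natAdd n, Fin.natAdd_injective _ _⟩).filter fun z => ω' ∈ openConn (Fin.castAdd k v) z).card =
      (A.filter fun z => restrictConfig (Fin.castAdd k) ω' ∈ openConn v z).card +
        (if restrictConfig (Fin.castAdd k) ω' ∈ openConn v b then k else 0) := by
  rw [Finset.filter_union, Finset.card_union_of_disjoint]
  · congr 1
    · rw [Finset.filter_map, Finset.card_map]
      congr 1
      ext a
      simp only [Finset.mem_filter, Function.Embedding.coeFn_mk, Function.comp_apply, and_congr_right_iff]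
      intro _
      exact reachable_castAdd_iff hω v a
    · rw [Finset.filter_map, Finset.card_map]
      by_cases hvb : restrictConfig (Fin.castAdd k) ω' ∈ openConn v b
      · rw [if_pos hvb]
        have : (Finset.univ : Finset (Fin k)).filter
            ((fun z => ω' ∈ openConn (Fin.castAdd k v) z) ∘ ⇑(⟨Fin.natAdd n, Fin.natAdd_injective _ _⟩ :
              Fin k ↪ Fin (n + k))) = Finset.univ := by
          refine Finset.filter_true_of_mem fun i _ => ?_
          simp only [Function.comp_apply, Function.Embedding.coeFn_mk]
          exact (reachable_natAdd_iff hω v i).2 hvb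
        rw [this, Finset.card_univ, Fintype.card_fin]
      · rw [if_neg hvb]
        have : (Finset.univ : Finset (Fin k)).filter
            ((fun z => ω' ∈ openConn (Fin.castAdd k v) z) ∘ ⇑(⟨Fin.natAdd n, Fin.natAdd_injective _ _⟩ :
              Fin k ↪ Fin (n + k))) = ∅ := by
          refine Finset.filter_false_of_mem fun i _ => ?_
          simp only [Function.comp_apply, Function.Embedding.coeFn_mk]
          exact fun h => hvb ((reachable_natAdd_iff hω v i).1 h)
        rw [this, Finset.card_empty]
  · rw [Finset.disjoint_left]
    intro z hz1 hz2
    rw [Finset.mem_filter, Finset.mem_map] at hz1 hz2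
    obtain ⟨⟨a, _, rfl⟩, _⟩ := hz1
    obtain ⟨⟨i, _, hi⟩, _⟩ := hz2
    exact castAdd_ne_natAdd a i hi.symm

/-- **A hub's block is big**: on a good configuration `|π_{A'}(h_i)| ≥ k`. [folklore] -/
theorem card_filter_relays'_natAdd {b : Fin n} {ω' : BondConfig (Fin (n + k))} (hω : ((∀ i : Fin k, s(Fin.castAdd k b, Fin.natAdd n i) ∈ ω') ∧
      ∀ e' ∈ ω', (∃ e : Sym2 (Fin n), Sym2.map (Fin.castAdd k) e = e') ∨
        ∃ i : Fin k, e' = s(Fin.castAdd k b, Fin.natAdd n i)))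
    (A : Finset (Fin n)) (i : Fin k) :
    k ≤ ((A.map ⟨Fin.castAdd k, Fin.castAdd_injective _ _⟩ ∪
      (Finset.univ : Finset (Fin k)).map ⟨Fin.natAdd n, Fin.natAdd_injective _ _⟩).filter fun z => ω' ∈ openConn (Fin.natAdd n i) z).card := by
  have hsub : (Finset.univ : Finset (Fin k)).map ⟨Fin.natAdd n, Fin.natAdd_injective _ _⟩ ⊆
      (A.map ⟨Fin.castAdd k, Fin.castAdd_injective _ _⟩ ∪
      (Finset.univ : Finset (Fin k)).map ⟨Fin.natAdd n, Fin.natAdd_injective _ _⟩).filter fun z => ω' ∈ openConn (Fin.natAdd n i) z := by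
    intro z hz
    rw [Finset.mem_map] at hz
    obtain ⟨i', _, rfl⟩ := hz
    rw [Finset.mem_filter]
    exact ⟨(mem_relays'_iff A _).2 (Or.inr ⟨i', rfl⟩), reachable_natAdd_natAdd hω i i'⟩
  have := Finset.card_le_card hsub
  rwa [Finset.card_map, Finset.card_univ, Fintype.card_fin] at this

/-- **The hub weight**: old pairs keep their weight, hub edges get weight `1`, all other new pairs `0`. [folklore] -/
theorem exists_hubWeight (w : Sym2 (Fin n) → unitInterval) (b : Fin n) (k : ℕ) :
    ∃ w' : Sym2 (Fin (n + k)) → unitInterval,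
      (∀ e : Sym2 (Fin n), w' (Sym2.map (Fin.castAdd k) e) = w e) ∧
      (∀ i : Fin k, w' s(Fin.castAdd k b, Fin.natAdd n i) = 1) ∧
      (∀ e', (¬ ∃ e : Sym2 (Fin n), Sym2.map (Fin.castAdd k) e = e') →
        (¬ ∃ i : Fin k, e' = s(Fin.castAdd k b, Fin.natAdd n i)) → w' e' = 0) := by
  have hinj : Function.Injective (Sym2.map (Fin.castAdd k : Fin n → Fin (n + k))) :=
    Sym2.map.injective (Fin.castAdd_injective _ _)
  refine ⟨fun e' => if h : ∃ e : Sym2 (Fin n), Sym2.map (Fin.castAdd k) e = e' then w h.choose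
      else if ∃ i : Fin k, e' = s(Fin.castAdd k b, Fin.natAdd n i) then 1 else 0, ?_, ?_, ?_⟩
  · intro e
    have h : ∃ e₀ : Sym2 (Fin n), Sym2.map (Fin.castAdd k) e₀ = Sym2.map (Fin.castAdd k) e := ⟨e, rfl⟩
    simp only [h, dif_pos]
    exact congrArg w (hinj h.choose_spec)
  · intro i
    have h : ¬ ∃ e : Sym2 (Fin n), Sym2.map (Fin.castAdd k) e = s(Fin.castAdd k b, Fin.natAdd n i) := by
      rintro ⟨e, he⟩
      induction e using Sym2.ind with
      | h u v =>
        rw [Sym2.map_mk, Sym2.eq_iff] at he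
        rcases he with ⟨_, h2⟩ | ⟨h1, _⟩
        · exact castAdd_ne_natAdd v i h2
        · exact castAdd_ne_natAdd u i h1
    have h' : ∃ i' : Fin k, s(Fin.castAdd k b, Fin.natAdd n i) = s(Fin.castAdd k b, Fin.natAdd n i') := ⟨i, rfl⟩
    simp only [h, dif_neg, not_false_eq_true, h', if_pos]
  · intro e' h1 h2
    simp only [h1, dif_neg, not_false_eq_true, h2, if_neg]

/-- **Good configurations have full measure** under the hub weight. [folklore] -/
theorem ae_good (b : Fin n) (k : ℕ)
    (w' : Sym2 (Fin (n + k)) → unitInterval)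
    (h1 : ∀ i : Fin k, w' s(Fin.castAdd k b, Fin.natAdd n i) = 1)
    (h0 : ∀ e', (¬ ∃ e : Sym2 (Fin n), Sym2.map (Fin.castAdd k) e = e') →
      (¬ ∃ i : Fin k, e' = s(Fin.castAdd k b, Fin.natAdd n i)) → w' e' = 0) :
    ∀ᵐ ω' ∂(prodBernoulli w'), ((∀ i : Fin k, s(Fin.castAdd k b, Fin.natAdd n i) ∈ ω') ∧
      ∀ e' ∈ ω', (∃ e : Sym2 (Fin n), Sym2.map (Fin.castAdd k) e = e') ∨
        ∃ i : Fin k, e' = s(Fin.castAdd k b, Fin.natAdd n i)) := by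
  have hall : ∀ e' : Sym2 (Fin (n + k)), ∀ᵐ ω' ∂(prodBernoulli w'),
      ((∃ i : Fin k, e' = s(Fin.castAdd k b, Fin.natAdd n i)) → e' ∈ ω') ∧
      (e' ∈ ω' → (∃ e : Sym2 (Fin n), Sym2.map (Fin.castAdd k) e = e') ∨
        ∃ i : Fin k, e' = s(Fin.castAdd k b, Fin.natAdd n i)) := by
    intro e'
    by_cases hhub : ∃ i : Fin k, e' = s(Fin.castAdd k b, Fin.natAdd n i)
    · obtain ⟨i, rfl⟩ := hhub
      filter_upwards [prodBernoulli_ae_mem_of_eq_one w' (h1 i)] with ω' h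
      exact ⟨fun _ => h, fun _ => Or.inr ⟨i, rfl⟩⟩
    · by_cases himg : ∃ e : Sym2 (Fin n), Sym2.map (Fin.castAdd k) e = e'
      · exact Filter.Eventually.of_forall fun ω' => ⟨fun h => absurd h hhub, fun _ => Or.inl himg⟩
      · filter_upwards [prodBernoulli_ae_notMem w' (h0 e' himg hhub)] with ω' h
        exact ⟨fun h' => absurd h' hhub, fun h' => absurd h' h⟩
  rw [← ae_all_iff] at hall
  filter_upwards [hall] with ω' h
  exact ⟨fun i => (h _).1 ⟨i, rfl⟩, fun e' he' => (h e').2 he'⟩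

/-- **Transport of probabilities to the original graph.**  If `S'` and `(restrictConfig)⁻¹ S` agree on good
configurations then `μ'(S') = μ(S)`. [folklore] -/
theorem real_eq_of_good (w : Sym2 (Fin n) → unitInterval) (b : Fin n) (k : ℕ)
    (w' : Sym2 (Fin (n + k)) → unitInterval)
    (hw : ∀ e : Sym2 (Fin n), w' (Sym2.map (Fin.castAdd k) e) = w e)
    (h1 : ∀ i : Fin k, w' s(Fin.castAdd k b, Fin.natAdd n i) = 1)
    (h0 : ∀ e', (¬ ∃ e : Sym2 (Fin n), Sym2.map (Fin.castAdd k) e = e') →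
      (¬ ∃ i : Fin k, e' = s(Fin.castAdd k b, Fin.natAdd n i)) → w' e' = 0)
    (S' : Set (BondConfig (Fin (n + k)))) (S : Set (BondConfig (Fin n)))
    (hS : ∀ ω', ((∀ i : Fin k, s(Fin.castAdd k b, Fin.natAdd n i) ∈ ω') ∧
      ∀ e' ∈ ω', (∃ e : Sym2 (Fin n), Sym2.map (Fin.castAdd k) e = e') ∨
        ∃ i : Fin k, e' = s(Fin.castAdd k b, Fin.natAdd n i)) → (ω' ∈ S' ↔ restrictConfig (Fin.castAdd k) ω' ∈ S)) :
    (prodBernoulli w').real S' = (prodBernoulli w).real S := by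
  have hae : S' =ᵐ[prodBernoulli w'] ((restrictConfig (Fin.castAdd k)) ⁻¹' S : Set (BondConfig (Fin (n + k)))) := by
    filter_upwards [ae_good b k w' h1 h0] with ω' hω
    exact propext (hS ω' hω)
  rw [measureReal_congr hae]
  have hmap : (prodBernoulli w').map (restrictConfig (Fin.castAdd k)) = prodBernoulli w := by
    rw [prodBernoulli_map_restrictConfig w' (Fin.castAdd_injective _ _)]
    congr 1
    funext e
    exact hw e
  rw [← hmap, map_measureReal_apply (measurable_restrictConfig _) (Set.toFinite S).measurableSet]

end CILSharpHardness

end Summit.CriticalPhenomena.PercolationContinuityZ3.Theorems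

end
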